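import Mathlib
import HarnessLib
import HarnessLib.Audit
import Summits.CriticalPhenomena.Statement
import Literature.Probability.Percolation.PercolationEvents

/-!
Route: PercAntiMeanFieldOnset

DORMANT since 2026-08-29T15:23:55Z (reconciler: no traction for 5 d (last activity item-proof-filed at 2026-08-24T14:26:21Z); parked, not closed — `ledger route dormant route-CriticalPhenomena-PercAntiMeanFieldOnset --off` to reactivate) — unstaffed, not closed; items shared with open routes are served there. `ledger route dormant <id> --off` reactivates.

# Route PercAntiMeanFieldOnset — anti-mean-field onset (beta+ < 1) plus finite sea forces theta(p_c)
= 0, via Russo counted twice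

It suffices to show X = A ∧ L, realising card russo-twice-bridges-contacts-onset. A (ANTI-MEAN-FIELD
ONSET, β⁺ < 1):
there are κ, c, δ₀ > 0 with θ(q) − θ(p_c) ≥ c (q − p_c)^{1−κ} for all q ∈ (p_c, p_c + δ₀) — bond
percolation on ℤ³
leaves its critical point strictly faster than linearly (the mean-field bound, Grimmett1999 Thm
(5.8), is κ = 0; β < 1
is a theorem in d = 2 and false for d ≥ 11). L (shared with route PercTruncatedSusceptibility,
stmt-CriticalPhenomena-0852):
at every p with θ(p) > 0 the truncated susceptibility χ^f(p) = Σ_x P_p(0 ↔ x, |C(0)| < ∞) is finite.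
The glue is
elementary and provable now: a coupling form of Russo's 1978 bound, (1 − p)(θ(q) − θ(p)) ≤ 6 (q − p)
χ^f(p)
(OnsetIncrementBound), so a jump θ(p_c) > 0 with finite sea (L) would make θ right-Lipschitz at p_c,
which A forbids;
the exact load-bearing node 'a jump forces a steep onset' is filed as JumpForcesSteepOnset.
Lean: `(∃ κ c δ₀ : ℝ, 0 < κ ∧ 0 < c ∧ 0 < δ₀ ∧ ∀ q : unitInterval,
Literature.Probability.Percolation.criticalProb (Literature.Probability.LatticeModels.zdGraph 3) 0 <
(q : ℝ) → (q : ℝ) < Literature.Probability.Percolation.criticalProb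
(Literature.Probability.LatticeModels.zdGraph 3) 0 + δ₀ → c * ((q : ℝ) -
Literature.Probability.Percolation.criticalProb (Literature.Probability.LatticeModels.zdGraph 3) 0)
^ (1 - κ) ≤ Literature.Probability.Percolation.theta (Literature.Probability.LatticeModels.zdGraph
3) 0 q - Literature.Probability.Percolation.theta (Literature.Probability.LatticeModels.zdGraph 3) 0
(Literature.Probability.Percolation.criticalProbI 3)) ∧ (∀ p : unitInterval, 0 <
Literature.Probability.Percolation.theta (Literature.Probability.LatticeModels.zdGraph 3) 0 p →
Summable fun x : Literature.Probability.LatticeModels.Site 3 =>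
(Literature.Probability.Percolation.bondPercolation (Literature.Probability.LatticeModels.zdGraph 3)
p).real (Literature.Probability.Percolation.openConn 0 x \
Literature.Probability.Percolation.percolatesAt 0))`

## Assembly
By contradiction, sorry-free in the planner's Sketch.lean (theorem assembly_holds): if θ(p_c) ≠ 0
then θ(p_c) > 0
(measureReal_nonneg); L at p = criticalProbI 3 gives S := Σ_x P_{p_c}(0 ↔ x, |C| < ∞) < ∞
(Summable); OnsetIncrementBound at
p = p_c gives (1 − p_c)(θ(q) − θ(p_c)) ≤ 6 (q − p_c) S for all q ≥ p_c; p_c < 1 is PROVED in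
Literature
(Literature.Probability.Percolation.Grimmett1999_criticalProb_pos_lt_one_holds), so θ(q) − θ(p_c) ≤
(6S/(1 − p_c))(q − p_c),
contradicting JumpForcesSteepOnset at C = 6S/(1 − p_c). AntiMeanFieldOnset enters through
JumpForcesSteepOnset (glue
antiMeanField_implies_steep, also sorry-free in the sketch). No unproved named fact is used anywhere
in the route.

Rationale: WHY THIS LINE. Count Russo's pivotal edges for {0 ↔ ∞} twice: pivotality of e is independent of ω_e,
so (1 − p)·E_p[#open pivotals = bridges
of the infinite cluster at 0] = p·E_p[#closed pivotals = closed contacts between the finite cluster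
F = C(0) and the infinite
cluster] ≤ 6p·χ^f(p) exactly (BridgeBound), and in the monotone coupling the first fresh edge that
lets 0 join the infinite
cluster between levels p and q is a p-closed edge of ∂F, whence (1 − p)(θ(q) − θ(p)) ≤ 6(q −
p)χ^f(p) with χ^f taken AT the
left endpoint (OnsetIncrementBound; Russo1978 and Grimmett1999 Thm (8.92) p.224 have the derivative
form on (p_c, 1]). Hence a
first-order transition on ℤ³ with a massive sea (χ^f(p_c) < ∞, the negation of
PercTruncatedSusceptibility's crux H) must
START ITS SUPERCRITICAL PHASE GENTLY (right-Lipschitz), and the whole content of H moves across p_c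
into ONE anti-mean-field
exponent inequality from above, β⁺ < 1 — the dual of Newman's criterion from below (Newman1986: a
jump forces γ ≥ 2).
Imported area: near-critical exponent inequalities / scaling theory (KestenScalingCMP1987 and
KestenZhang1987 prove β < 1 in
d = 2; ChayesChayes1987, Tasaki1987, Hutchcroft2020 for the inventory of rigorous inequalities, none
of which couples the
onset from above to χ^f at p_c; FitznerVanDerHofstad2017: β = 1 for d ≥ 11, so the engine is
intrinsically low-dimensional).
What it does that prior routes do not: PercTruncatedSusceptibility attacks H with
finite-cluster/ghost-field tools AT p_c in the
counterfactual world; this line replaces H by a statement about the real function θ on (p_c, 1],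
where supercritical and
scaling technology live, and files the two provable-now identities that make the replacement exact.
Negatives index: nothing
on percolation (1 SAW item).

RANKED CRUXES. #2 AntiMeanFieldOnset (crux) — card K1 (β⁺ < 1, 'OnsetSuperLinear'): ∃ κ, c, δ₀ > 0
such that for every q ∈ [0,1] with p_c(ℤ³) < q < p_c + δ₀, θ(q) − θ(p_c) ≥ c (q − p_c)^{1−κ} (bond
percolation on zdGraph 3, θ = theta (zdGraph 3) 0, p_c = criticalProb (zdGraph 3) 0; truth β ≈ 0.42
so κ may be as large as ≈ 0.58; unconditional — it does not mention θ(p_c)). [difficulty: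
open-problem] (why it might fail: No strict non-mean-field bound on β (or γ, δ) is proved in any 3 ≤
d ≤ 6 (only CCFS-type ν ≥ 2/d); supercritical tools (Grimmett–Marstrand, analyticity) are fixed-p
and lose uniformity as q↓p_c; the d=2 proof (Kesten scaling + strict arm inequalities) needs RSW;
false for d ≥ 11 (β = 1).) [Grimmett1999, KestenScalingCMP1987, KestenZhang1987,
FitznerVanDerHofstad2017, Hutchcroft2020, ChayesChayes1987]
#3 TruncatedSusceptibilityFiniteOfTheta (crux) — L, verbatim the crux r3 of route
PercTruncatedSusceptibility (stmt-CriticalPhenomena-0852, shared): at every p with θ(p) > 0 the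
truncated connectivity of bond percolation on ℤ³ is summable, Σ_x P_p(0 ↔ x, |C(0)| < ∞) < ∞. Known
for p > p_c (Grimmett1999 Thm (8.18) with (8.21) and (8.51), ChayesChayesNewman1987, via a slab
percolating at p); the live case is a hypothetical percolating p_c. Only its consequence
E_{p_c}[|∂C(0)|; |C(0)| < ∞] < ∞ is used by the assembly. [difficulty: open-problem] (why it might
fail: θ(p)>0 ⇏ χ^f(p)<∞ in general: 1-d 1/r² percolation has M>0 with χ'=Στ'=∞ (Imbrie–Newman 1988
Cor 1.5). On ℤ³ the only engine (Grimmett1999 Thm (8.21)→(8.51), CCN87) needs a slab percolating at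
p; at p=p_c none does (DST2016 Thm 1): the live case has no tool.) [Grimmett1999,
ChayesChayesNewman1987, doi:10.1007/bf01218582, DuminilCopinSidoraviciusTassion2016]
#4 JumpForcesSteepOnset (crux) — the exact load-bearing node (card's two readings meet here): IF
θ(p_c) > 0 THEN the right difference quotients of θ at p_c are unbounded — for every C there is q >
p_c with θ(q) − θ(p_c) > C (q − p_c). Implied by AntiMeanFieldOnset (drop the hypothesis; glue
sorry-free in the planner sketch) and, through BridgeBound's identity plus Grimmett1999 (2.28) p.43
(for ANY increasing A, liminf_{δ↓0} (P_{p+δ}(A) − P_p(A))/δ ≥ E_p N(A)) applied to A = {0 ↔ ∞}, by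
'the critical infinite cluster has infinitely many bridges at 0 in expectation'; in a jump world it
says E_{p_c}[#closed edges joining the finite C(0) to the infinite cluster] = ∞. Its d = 2 analogue
is recorded as known in Grimmett1999 p.43 ('(θ(p) − θ(p_c))/(p − p_c) … tends to ∞ as p ↓ p_c', two
dimensions). [deps: AntiMeanFieldOnset] [difficulty: open-problem] (why it might fail: Vacuous if
θ(p_c)=0, so its content is counterfactual: it is the contact form of H (E[contacts]=∞ ⇒ χ^f(p_c)=∞)
and no tool controls finite clusters at a percolating p_c; a 'massive sea, few bridges' jump world
(χ^f<∞, E[bridges]<∞) passes every known inequality.) [Russo1978, Grimmett1999, Newman1986,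
AizenmanKestenNewman1987]
#9 OnsetIncrementBound (support) — for p ≤ q in [0,1] with χ^f(p) = Σ_x P_p(0 ↔ x, |C(0)| < ∞) < ∞:
(1 − p)(θ(q) − θ(p)) ≤ 6 (q − p) χ^f(p). Proof by the monotone coupling of the prelude
(labelMeasure, configOfLabels, map_configOfLabels_holds): if 0 ↔ ∞ at level q but not at level p,
the p-cluster F = C_p(0) is finite while C_q(0) ⊋ F, and the first edge leaving F on a q-open path
from 0 to a vertex of C_q(0) outside F is a p-closed edge e of the edge boundary ∂F with label U_e ∈
(p, q] (no infinite path / König argument needed); for a fixed lattice edge e the event {e ∈ ∂F, |F|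
< ∞} is {U_e > p} ∩ G_e with G_e measurable w.r.t. the other labels, so P(e ∈ ∂F, |F| < ∞, U_e ∈ (p,
q]) = ((q − p)/(1 − p))·P_p(e ∈ ∂F, |F| < ∞); sum over e (union bound, Tonelli) and use |∂F| ≤ 6|F|,
E_p[|F|; |F| < ∞] = Σ_x P_p(0 ↔ x, |C| < ∞). Russo 1978 / Grimmett1999 Thm (8.92) (PDF p.237–238:
|d/dp P_p(|C| = n)| ≤ (2dn/pq) P_p(|C| = n)) is the derivative form on (p_c, 1]; the point here is
χ^f at the LEFT endpoint, which may be p_c itself. Holds verbatim on any graph of maximal degree Δ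
with 6 ↦ Δ. [difficulty: provable-now] [Russo1978, Grimmett1999]
#9 BridgeBound (support) — 'Russo counted twice', in [0, ∞] and for every p: (1 − p)·E_p[#open
pivotal edges of the event {0 ↔ ∞}] ≤ 6p·Σ_x P_p(0 ↔ x, |C(0)| < ∞). Proof: pivotality of e for A =
percolatesAt 0 does not depend on ω_e (isPivotal_insert_iff; Grimmett1999 p.43–44, the step before
(2.29): 'the event {e is pivotal for A} is independent of the state of e') and P_p is a product
measure with non-edges a.s. closed, so for every lattice edge e, (1 − p)·P(e pivotal, e open) = p(1
− p)·P(e pivotal) = p·P(e pivotal, e closed); summing (Tonelli) gives the EXACT identity (1 − p)E[b]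
= pE[c], where b = #open pivotals = bridges of the infinite cluster separating 0 from ∞ (nonzero
only on {0 ↔ ∞}) and c = #closed pivotals = closed edges joining the finite C(0) to an infinite
cluster (nonzero only on {|C(0)| < ∞}), and c ≤ |∂C(0)|·1{|C(0)| < ∞} ≤ 6|C(0)|·1{|C(0)| < ∞}.
Consequence recorded for refuters of H (stmt-CriticalPhenomena-0850): in a jump world with χ^f(p_c)
< ∞ the critical infinite cluster is held to infinity by finitely many bridges in expectation and
the sea touches it along finitely many closed edges in expectation. [difficulty: provable-now]
[Russo1978, Grimmett1999, AizenmanKestenNewman1987]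

TWO-LAYER PLAN. Foreseen, not filed: JumpForcesSteepOnset ⇐ AntiMeanFieldOnset (k = 1, glue proved
in the sketch) — the unconditional
exponent engine; ALTERNATIVELY JumpForcesSteepOnset ⇐ CriticalBridgesProliferate (θ(p_c) > 0 →
E_{p_c}[#open pivotals of
{0 ↔ ∞}] = ∞) with glue = BridgeBound's exact identity + Grimmett1999 (2.28) (liminf of the right
difference quotient ≥ E_p N(A) for every
increasing A; the card's 'bridges' reading; a separate route if both are pursued).
AntiMeanFieldOnset ⇐ (an exponent inequality from above of hyperscaling type, e.g. a
rigorous β ≤ 1 − κ from quantitative supercritical sharpness) — shape unknown, deliberately not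
split. L ⇐
FiniteRadiusExpDecayOfTheta (stmt-CriticalPhenomena-0853, other route) or the weaker edge-boundary
moment
'θ(p) > 0 → E_p[|∂C(0)|; |C(0)| < ∞] < ∞', which is all the assembly uses.

KILL CRITERIA. AntiMeanFieldOnset refuted unconditionally (θ(q) − θ(p_c) ≤ C(q − p_c) near p_c on
ℤ³, i.e. with Grimmett1999 Thm (5.8)
a mean-field onset β = 1 in d = 3): close `refuted:AntiMeanFieldOnset` — the conditional node
JumpForcesSteepOnset would then be
false in the jump world only through ¬L, and the line has nothing left beyond
PercTruncatedSusceptibility. L refuted by a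
percolating p with χ^f(p) = ∞: if the witness is p > p_c it contradicts Grimmett1999 (8.51) (check
the formalisation); if it
is p = p_c the summit conjunct is FALSE (θ(p_c) > 0) and everything closes. H
(stmt-CriticalPhenomena-0850) proved elsewhere:
with L the sub-problem closes through PercTruncatedSusceptibility and this route is moot (close
superseded). A refuter
showing JumpForcesSteepOnset ∧ L ⇔ θ(p_c) = 0 from KNOWN facts alone (making AntiMeanFieldOnset
decorative) downgrades the
route to a variant: keep the two support lemmas, close superseded.

NOT DECOMPOSED YET. The proof technology for AntiMeanFieldOnset (which inequality from above:
hyperscaling / Tasaki-type finite-size scaling,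
quantitative Grimmett–Marstrand (DuminilcopinKozmaTassion2020), Chayes–Chayes
upper-critical-dimension inequalities; the
d = 2 template needs RSW and has no 3-d analogue); the bridges child and its Fatou glue; the
weakening of L to the
edge-boundary moment; site percolation; general d (all statements are for d = 3; the two support
lemmas hold on any
bounded-degree graph with 6 ↦ max degree); constants (6 = 2d, the factor 1 − p).

CHEAPEST FALSIFIER. Vacuity audit first (refuters' standard move on this sub-problem): show that
JumpForcesSteepOnset is equivalent to
θ(p_c) = 0, or to H, using known facts only — I could not: JumpForcesSteepOnset ∧ L ⇒ continuity
needs L AT p_c (open), and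
conversely JumpForcesSteepOnset ⇒ H holds (via OnsetIncrementBound) but not H ⇒
JumpForcesSteepOnset. Second: a literature
lookup whether the left-endpoint increment bound and the bridge/contact identity are already printed
(Russo1978 §3,
BarskyGrimmettNewman1991, Grimmett1999 §8.7) — if both are, the route's novelty is only the exponent
reading (grade
variant). Third, numerics cannot refute an exponent inequality, but β(d = 3) ≈ 0.42 (margin 0.58
below mean field) is
what makes A credible; a consensus value near 1 would have killed the line. Ran myself: Sketch.lean
(lean check rc 0, no
sorry) proves Assembly and A → JumpForcesSteepOnset, so the logical skeleton is not in doubt.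

NUMBERS. β ≤ 1 in all d (θ(p) − θ(p_c) ≥ a(p − p_c), Grimmett1999 Thm (5.8) p.89, ChayesChayes1987 /
AizenmanBarsky1987);
β < 1 rigorous in d = 2 (Grimmett1999 §10.4 p.279 table after Kesten 1987b, and p.43: (θ(p) −
θ(p_c))/(p − p_c) → ∞ as p ↓ p_c in two dimensions; KestenScalingCMP1987, KestenZhang1987;
β = 5/36 for site percolation on the triangular lattice, SmirnovWerner2001); β = 1 (bounded ratio)
for d ≥ 11
(FitznerVanDerHofstad2017 Cor 1.3, Literature fact FitznerVanDerHofstad2017_beta_eq_one); Monte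
Carlo d = 3:
β = ν(3 − d_f) ≈ 0.88·0.477 ≈ 0.42 (arXiv:1302.0421, d_f = 2.523, 1/ν ≈ 1.141); p_c(ℤ³, bond) ≈
0.2488
(arXiv:1302.0421). Constant in the support lemmas: 6 = 2d. Items at open: 6 (3 cruxes, 2 support, 1
assembly).

DEFINITION REQUESTS. None. Everything is stated over existing prelude declarations (theta,
criticalProb, criticalProbI, bondPercolation,
openConn, percolatesAt, pivotals; lean search --decl checked). A Literature notion
truncSusceptibility d p :=
Σ'_x P_p(0 ↔ x, |C(0)| < ∞) would shorten H, L and both support lemmas; not requested, to keep L's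
signature identical
to stmt-CriticalPhenomena-0852 (dedup).

Novelty: Searches (2026-08-15): `lit search --hybrid "mean field bound percolation probability theta(p) -
theta(p_c) linear lower bound Chayes"` (12 held docs; read Grimmett1999 PDF p.102 Thm (5.8),
p.237–238 Thm (8.92), p.216 Lemma (8.9), p.292 §10.4 table; Kesten1982 PDF p.149–151 (8.4)–(8.9));
`lit vsearch "<if theta jumps then theta(p) − theta(p_c) grows at most linearly, bounded by the mean
finite-cluster size>"` (10 held docs, none states it); `lit search --source zbmath "critical
exponent inequalities percolation"` (20 rows: Newman 1987c zbl:0621.60113, doi:10.1007/bf01221395,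
Tasaki1987, KestenZhang1987, Hutchcroft2020, arXiv:2111.14414, arXiv:2410.23250); `lit search
--source zbmath "Kesten Zhang strict inequalities…"` (1); `lit frontier CriticalPhenomena --since
2020` (30 rows, none on the 3-d onset exponent); `ledger negatives --problem CriticalPhenomena` (1,
SAW); OpenAlex / Semantic Scholar / arXiv remote: HTTP 429 for the whole session; `lit galaxy search
… --star all`: galaxyd queue saturated (> 90 s), not obtained — the card's own audit (2026-08-15)
ran zbMATH/galaxy and found nothing joining the two halves.
Nearest prior art found: Russo1978 = Grimmett1999 Thm (8.92) PDF p.237–238 (|d/dp P_p(|C| = n)| ≤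
(2dn/pq)P_p(|C| = n), hence θ' ≤ 2dχ^f/(pq) on (p_c, 1] — the derivative form of
OnsetIncrementBound) and Lemma (8.9) p.216 (right-continuity of θ, Russo 1978); Newman1986 and
Newman 1987c zbl:0621.60113 (exponent criteria under a jump, from BELOW p_c: γ ≥ 2, γ' ≥ 2(1  [refs: 10.1007/bf01221395, 2111.14414, 2410.23250, doi:10.1007/bf01221395, Grimmett1999, Kesten1982, Tasaki1987, KestenZhang1987, Hutchcroft2020, Russo1978, Newman1986, KestenScalingCMP1987, FitznerVanDerHofstad2017]

Barriers (technique_class: pivotal-double-count, supercrit-onset, exponent-criterion): - technique_class: pivotal-double-count, supercrit-onset, exponent-criterion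
- Literature.Barriers.CriticalPhenomena.RandomClusterFirstOrder: calibrates, does not bite — at a
large-q first-order point the wired phase percolates with massive finite clusters (χ^f < ∞,
Grimmett2006 (7.79)) AND a gentle onset, exactly the '¬H ⇒ right-Lipschitz' pairing
OnsetIncrementBound predicts; the identity uses independence of ω_e from pivotality (q = 1 only) and
A is a q = 1, d = 3 exponent statement.
- Literature.Barriers.CriticalPhenomena.LongRangeDiscontinuity: the Aizenman–Newman 1/r² chain jumps
with a NON-summable truncated function in its percolating phase (Imbrie–Newman 1988 Cor 1.5), so
there L fails, not the onset node; L is stated for nearest-neighbour ℤ³ only and its known p > p_c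
proof is already range- and dimension-specific (same evasion as PercTruncatedSusceptibility); the
support lemmas hold there too and are consistent.
- Literature.Barriers.CriticalPhenomena.SprinklingRenormalisation: bites on any attempt to prove A
or L by Grimmett–Marstrand blocks (sprinkled constants give neither an exponent nor p = p_c); it
does not touch the support lemmas or the assembly; the bet is an exponent inequality from above by
non-sprinkled means (finite-size scaling / hyperscaling type, quantitative supercritical sharpness
DuminilcopinKozmaTassion2020).
- Literature.Barriers.CriticalPhenomena.LaceExpansionHighDimension: in d ≥ 11 β = 1, so A is FALSE
there while θ(p_c) = 0 is true — the en

Novelty grade: variant — ROUTE REVIEW (refuter 2026-08-15). Sound, precisely typed, NOT a recombination of closed routes (only PercHalfSpace closed in this sub; L shared with OPEN PercTruncatedSusceptibility/PercNecklaceBackbone). All 6 decls elaborate (W_perc.lean rc0); per-item stamps filed. Assembly 5110 PROVED by me (Pe (refuter refuter-rreview-route-AtomisticToContinu-40e6b8ec-0, 2026-08-15T14:05:35Z; prior: Russo1978 / Grimmett1999 Thm (8.92) PDF p.237-238 (derivative form of OnsetIncrementBound on (p_c,1]), Grimmett1999 Lemma (8.9) p.113 (right-continuity of theta) and pp.43-44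 before (2.29) (pivotality independent of omega_e), Newman1986 (jump => exponent inequalities from BELOW p_c): this route is its supercritical dual, route-CriticalPhenomena-PercTruncatedSusceptibility (L = stmt-0852 shared; H )

History (route lifecycle, newest last):
- 2026-08-29T15:23:55Z · DORMANT — reconciler: no traction for 5 d (last activity item-proof-filed at 2026-08-24T14:26:21Z); parked, not closed — `ledger route dormant route-CriticalPhenomena-Per (operator:999:1488875)

sub-problem: PercolationContinuityZ3 · status: dormant · opened planner-plancard-CriticalPhenomena-Percolatio-d3de0bd0-0 2026-08-15T11:39:59Z · rev 4 · ledger route-CriticalPhenomena-PercAntiMeanFieldOnset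
GENERATED by the gate from the ledger (D-0016/17). Provers cite these decls: `theorem foo : Summit.CriticalPhenomena.PercolationContinuityZ3.Theses.PercAntiMeanFieldOnset.<Decl> := …` in Summits/CriticalPhenomena/PercolationContinuityZ3/Theorems/<Name>.lean.
-/

namespace Summit.CriticalPhenomena.PercolationContinuityZ3.Theses.PercAntiMeanFieldOnset

open scoped BigOperators Topology Manifold Classical MeasureTheory ProbabilityTheory Matrix InnerProductSpace ComplexConjugate ContinuousMap
open Filter Set Function TopologicalSpace MeasureTheory

attribute [summit_statement] _root_.PercolationContinuityZ3

/-- item stmt-CriticalPhenomena-0852 · crux · rank 3 · closed · proved by Summit.CriticalPhenomena.PercolationContinuityZ3.Theorems.PercNecklaceBackboneTruncatedSusceptibilityFiniteOfTheta.truncatedSusceptibilityFiniteOfTheta_proof @ f5fa9107e126 (prover) · by planner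
why it might fail: Open only at a percolating p_c: for p>p_c it is Grimmett1999 Thms (8.18)–(8.21)+(8.51) (CCN87; the proof needs a slab percolating at p, and none does at p_c by DST2016 Thm 1); θ>0 with χ^f=∞ does occur in 1-d 1/r² percolation (Imbrie–Newman 1988 Cor 1.5), so no general principle gives it.
sources: Grimmett1999, ChayesChayesNewman1987, doi:10.1007/bf01218582, DuminilCopinSidoraviciusTassion2016
[crux] r3 = L: at every p with θ(p) > 0 the truncated connectivity of bond percolation on Z^3 is
summable: Σ_x P_p(0 ↔ x, |C(0)| < ∞) < ∞. Known for p > p_c: Grimmett1999 Thm (8.18) with (8.21)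
(σ(p) > 0, proof of ChayesChayesNewman1987 using a percolating slab at p, pp.210–212) and (8.51)
τ^f_p(0,x) ≤ A‖x‖^d e^{−σ‖x‖}. The live case is a hypothetical percolating p_c ("no sprinkling"). -/
@[route_item "route-CriticalPhenomena-PercAntiMeanFieldOnset"]
def TruncatedSusceptibilityFiniteOfTheta : Prop :=
  ∀ p : unitInterval, 0 < Literature.Probability.Percolation.theta (Literature.Probability.LatticeModels.zdGraph 3) 0 p → Summable fun x : Literature.Probability.LatticeModels.Site 3 => (Literature.Probability.Percolation.bondPercolation (Literature.Probability.LatticeModels.zdGraph 3) p).real (Literature.Probability.Percolation.openConn 0 x \ Literature.Probability.Percolation.percolatesAt 0)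

-- `TruncatedSusceptibilityFiniteOfTheta` holds: proved by `Summit.CriticalPhenomena.PercolationContinuityZ3.Theorems.PercNecklaceBackboneTruncatedSusceptibilityFiniteOfTheta.truncatedSusceptibilityFiniteOfTheta_proof` @ f5fa9107e126 (its module imports this route file, so no `_holds` link can be stated here).

/-- item stmt-CriticalPhenomena-5107 · crux · rank 4 · closed · proved by Summit.CriticalPhenomena.PercolationContinuityZ3.Theorems.PercAntiMeanFieldOnsetJumpForcesSteepOnset.jumpForcesSteepOnset_proof @ 659d2b669b2c (prover) · by planner
why it might fail: False exactly in a jump world with right-Lipschitz onset — via OnsetIncrementBound/BridgeBound: θ(p_c)>0, χ^f(p_c)<∞, E[bridges]<∞ — which no known inequality excludes (Newman1986 bounds γ,δ from below p_c; Grimmett1999 (2.28) gives only liminf ≥ E_p N(A)); vacuous, hence unrefutable, if θ(p_c)=0.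
sources: Grimmett1999, Newman1986, Russo1978, AizenmanKestenNewman1987
[crux] the exact load-bearing node (card's two readings meet here): IF θ(p_c) > 0 THEN the right
difference quotients of θ at p_c are unbounded — for every C there is q > p_c with θ(q) − θ(p_c) > C
(q − p_c). Implied by AntiMeanFieldOnset (drop the hypothesis; glue sorry-free in the planner
sketch) and, through BridgeBound's identity plus Grimmett1999 (2.28) p.43 (for ANY increasing A,
liminf_{δ↓0} (P_{p+δ}(A) − P_p(A))/δ ≥ E_p N(A)) applied to A = {0 ↔ ∞}, by 'the critical infinite
cluster has infinitely many bridges at 0 in expectation'; in a jump world it says E_{p_c}[#closed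
edges joining the finite C(0) to the infinite cluster] = ∞. Its d = 2 analogue is recorded as known
in Grimmett1999 p.43 ('(θ(p) − θ(p_c))/(p − p_c) … tends to ∞ as p ↓ p_c', two dimensions). [deps:
AntiMeanFieldOnset] [difficulty: open-problem] -/
@[route_item "route-CriticalPhenomena-PercAntiMeanFieldOnset"]
def JumpForcesSteepOnset : Prop :=
  0 < Literature.Probability.Percolation.theta (Literature.Probability.LatticeModels.zdGraph 3) 0 (Literature.Probability.Percolation.criticalProbI 3) → ∀ C : ℝ, ∃ q : unitInterval, Literature.Probability.Percolation.criticalProb (Literature.Probability.LatticeModels.zdGraph 3) 0 < (q : ℝ) ∧ C * ((q : ℝ) - Literature.Probability.Percolation.criticalProb (Literature.Probability.LatticeModels.zdGraph 3) 0) < Literature.Probability.Percolation.theta (Literature.Probability.LatticeModels.zdGraph 3) 0 q - Literature.Probability.Percolation.theta (Literature.Probability.LatticeModels.zdGraph 3) 0 (Literature.Probability.Percolation.criticalProbI 3)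

-- `JumpForcesSteepOnset` holds: proved by `Summit.CriticalPhenomena.PercolationContinuityZ3.Theorems.PercAntiMeanFieldOnsetJumpForcesSteepOnset.jumpForcesSteepOnset_proof` @ 659d2b669b2c (its module imports this route file, so no `_holds` link can be stated here).

/-- item stmt-CriticalPhenomena-5106 · aside · rank 2 · open · by planner
why it might fail: β<1 on ℤ³ is open: every rigorous inequality (Hutchcroft2020 §1: β≤1, βδ≥2, β(δ−1)≥1, γ≤δ−1) bounds β from the mean-field side only; Grimmett1999 Thm (5.8) is the κ=0 case; the d=2 proof (KestenZhang1987) needs RSW/Kesten scaling; β=1 for d≥11 (FitznerVanDerHofstad2017), so only d<6 input can work.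
sources: Grimmett1999, Hutchcroft2020, KestenZhang1987, KestenScalingCMP1987, FitznerVanDerHofstad2017, ChayesChayes1987
[crux] card K1 (β⁺ < 1, 'OnsetSuperLinear'): ∃ κ, c, δ₀ > 0 such that for every q ∈ [0,1] with
p_c(ℤ³) < q < p_c + δ₀, θ(q) − θ(p_c) ≥ c (q − p_c)^{1−κ} (bond percolation on zdGraph 3, θ = theta
(zdGraph 3) 0, p_c = criticalProb (zdGraph 3) 0; truth β ≈ 0.42 so κ may be as large as ≈ 0.58;
unconditional — it does not mention θ(p_c)). [difficulty: open-problem] -/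
@[route_item "route-CriticalPhenomena-PercAntiMeanFieldOnset"]
def AntiMeanFieldOnset : Prop :=
  ∃ κ c δ₀ : ℝ, 0 < κ ∧ 0 < c ∧ 0 < δ₀ ∧ ∀ q : unitInterval, Literature.Probability.Percolation.criticalProb (Literature.Probability.LatticeModels.zdGraph 3) 0 < (q : ℝ) → (q : ℝ) < Literature.Probability.Percolation.criticalProb (Literature.Probability.LatticeModels.zdGraph 3) 0 + δ₀ → c * ((q : ℝ) - Literature.Probability.Percolation.criticalProb (Literature.Probability.LatticeModels.zdGraph 3) 0) ^ (1 - κ) ≤ Literature.Probability.Percolation.theta (Literature.Probability.LatticeModels.zdGraph 3) 0 q - Literature.Probability.Percolation.theta (Literature.Probability.LatticeModels.zdGraph 3) 0 (Literature.Probability.Percolation.criticalProbI 3)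

/-- item stmt-CriticalPhenomena-5108 · support · rank 9 · closed · proved by Summit.CriticalPhenomena.PercolationContinuityZ3.Theorems.OnsetIncrement.onsetIncrementBound_proof @ dc308762073c (prover) · by planner
sources: Russo1978, Grimmett1999
[support] for p ≤ q in [0,1] with χ^f(p) = Σ_x P_p(0 ↔ x, |C(0)| < ∞) < ∞: (1 − p)(θ(q) − θ(p)) ≤ 6
(q − p) χ^f(p). Proof by the monotone coupling of the prelude (labelMeasure, configOfLabels,
map_configOfLabels_holds): if 0 ↔ ∞ at level q but not at level p, the p-cluster F = C_p(0) is
finite while C_q(0) ⊋ F, and the first edge leaving F on a q-open path from 0 to a vertex of C_q(0)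
outside F is a p-closed edge e of the edge boundary ∂F with label U_e ∈ (p, q] (no infinite path /
König argument needed); for a fixed lattice edge e the event {e ∈ ∂F, |F| < ∞} is {U_e > p} ∩ G_e
with G_e measurable w.r.t. the other labels, so P(e ∈ ∂F, |F| < ∞, U_e ∈ (p, q]) = ((q − p)/(1 −
p))·P_p(e ∈ ∂F, |F| < ∞); sum over e (union bound, Tonelli) and use |∂F| ≤ 6|F|, E_p[|F|; |F| < ∞] =
Σ_x P_p(0 ↔ x, |C| < ∞). Russo 1978 / Grimmett1999 Thm (8.92) (PDF p.237–238: |d/dp P_p(|C| = n)| ≤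
(2dn/pq) P_p(|C| = n)) is the derivative form on (p_c, 1]; the point here is χ^f at the LEFT
endpoint, which may be p_c itself. Holds verbatim on any graph of maximal degree Δ with 6 ↦ Δ.
[difficulty: provable-now] -/
@[route_item "route-CriticalPhenomena-PercAntiMeanFieldOnset"]
def OnsetIncrementBound : Prop :=
  ∀ p q : unitInterval, p ≤ q → Summable (fun x : Literature.Probability.LatticeModels.Site 3 => (Literature.Probability.Percolation.bondPercolation (Literature.Probability.LatticeModels.zdGraph 3) p).real (Literature.Probability.Percolation.openConn 0 x \ Literature.Probability.Percolation.percolatesAt 0)) → (1 - (p : ℝ)) * (Literature.Probability.Percolation.theta (Literature.Probability.LatticeModels.zdGraph 3) 0 q - Literature.Probability.Percolation.theta (Literature.Probability.LatticeModels.zdGraph 3) 0 p) ≤ 6 * ((q : ℝ) - p) * ∑' x : Literature.Probability.LatticeModels.Site 3, (Literature.Probability.Percolation.bondPercolation (Literature.Probability.LatticeModels.zdGraph 3) p).real (Literature.Probability.Percolation.openConn 0 x \ Literature.Probability.Percolation.percolatesAt 0)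

-- `OnsetIncrementBound` holds: proved by `Summit.CriticalPhenomena.PercolationContinuityZ3.Theorems.OnsetIncrement.onsetIncrementBound_proof` @ dc308762073c (its module imports this route file, so no `_holds` link can be stated here).

/-- item stmt-CriticalPhenomena-5109 · support · rank 9 · closed · proved by Summit.CriticalPhenomena.PercolationContinuityZ3.Theorems.Bridges.bridgeBound_proof @ e8a0ce04c7ec (prover) · by planner
sources: Russo1978, Grimmett1999, AizenmanKestenNewman1987
[support] 'Russo counted twice', in [0, ∞] and for every p: (1 − p)·E_p[#open pivotal edges of the
event {0 ↔ ∞}] ≤ 6p·Σ_x P_p(0 ↔ x, |C(0)| < ∞). Proof: pivotality of e for A = percolatesAt 0 does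
not depend on ω_e (isPivotal_insert_iff; Grimmett1999 p.43–44, the step before (2.29): 'the event {e
is pivotal for A} is independent of the state of e') and P_p is a product measure with non-edges
a.s. closed, so for every lattice edge e, (1 − p)·P(e pivotal, e open) = p(1 − p)·P(e pivotal) =
p·P(e pivotal, e closed); summing (Tonelli) gives the EXACT identity (1 − p)E[b] = pE[c], where b =
#open pivotals = bridges of the infinite cluster separating 0 from ∞ (nonzero only on {0 ↔ ∞}) and c
= #closed pivotals = closed edges joining the finite C(0) to an infinite cluster (nonzero only on
{|C(0)| < ∞}), and c ≤ |∂C(0)|·1{|C(0)| < ∞} ≤ 6|C(0)|·1{|C(0)| < ∞}. Consequence recorded for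
refuters of H (stmt-CriticalPhenomena-0850): in a jump world with χ^f(p_c) < ∞ the critical infinite
cluster is held to infinity by finitely many bridges in expectation and the sea touches it along
finitely many closed edges in expectation. [difficulty: provable-now] -/
@[route_item "route-CriticalPhenomena-PercAntiMeanFieldOnset"]
def BridgeBound : Prop :=
  ∀ p : unitInterval, ENNReal.ofReal (1 - (p : ℝ)) * ∫⁻ ω, ((Literature.Probability.Percolation.pivotals (Literature.Probability.Percolation.percolatesAt (0 : Literature.Probability.LatticeModels.Site 3)) ω ∩ ω).encard : ENNReal) ∂(Literature.Probability.Percolation.bondPercolation (Literature.Probability.LatticeModels.zdGraph 3) p) ≤ 6 * ENNReal.ofReal (p : ℝ) * ∑' x : Literature.Probability.LatticeModels.Site 3, Literature.Probability.Percolation.bondPercolation (Literature.Probability.LatticeModels.zdGraph 3) p (Literature.Probability.Percolation.openConn 0 x \ Literature.Probability.Percolation.percolatesAt 0)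

-- `BridgeBound` holds: proved by `Summit.CriticalPhenomena.PercolationContinuityZ3.Theorems.Bridges.bridgeBound_proof` @ e8a0ce04c7ec (its module imports this route file, so no `_holds` link can be stated here).

/-- item stmt-CriticalPhenomena-5110 · assembly · rank 1 · closed · proved by Summit.CriticalPhenomena.PercolationContinuityZ3.Theorems.PercAntiMeanFieldOnsetAssembly.assembly_proof @ 33706488ffa0 (prover) · by planner
sources: Grimmett1999, Russo1978
[assembly] JumpForcesSteepOnset → OnsetIncrementBound → TruncatedSusceptibilityFiniteOfTheta →
PercolationContinuityZ3 (pure real-number algebra plus p_c(ℤ³) < 1). -/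
@[route_item "route-CriticalPhenomena-PercAntiMeanFieldOnset"]
def Assembly : Prop :=
  JumpForcesSteepOnset → OnsetIncrementBound → TruncatedSusceptibilityFiniteOfTheta → PercolationContinuityZ3

-- `Assembly` holds: proved by `Summit.CriticalPhenomena.PercolationContinuityZ3.Theorems.PercAntiMeanFieldOnsetAssembly.assembly_proof` @ 33706488ffa0 (its module imports this route file, so no `_holds` link can be stated here).

/-! D-0027 §2.1 — DECIDING THEOREM (planner-authored via `route open/edit --closes-file`; by planner-rrepair-CriticalPhenomena-PercAntiMean-af8559e4-g2-0 2026-08-15T16:54:12Z):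
its hypotheses are this route's items and its conclusion the sub-problem Statement (glue_lint), and it elaborates with this file. -/

@[closes "route-CriticalPhenomena-PercAntiMeanFieldOnset"] theorem closes (h_AntiMeanFieldOnset : AntiMeanFieldOnset) (h_TruncatedSusceptibilityFiniteOfTheta : TruncatedSusceptibilityFiniteOfTheta) (h_JumpForcesSteepOnset : JumpForcesSteepOnset) (h_OnsetIncrementBound : OnsetIncrementBound) (h_BridgeBound : BridgeBound) (h_Assembly : Assembly) : _root_.PercolationContinuityZ3 :=
  h_Assembly h_JumpForcesSteepOnset h_OnsetIncrementBound h_TruncatedSusceptibilityFiniteOfTheta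

end Summit.CriticalPhenomena.PercolationContinuityZ3.Theses.PercAntiMeanFieldOnset
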